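import Summits.ABC.ABC.Theorems.IneffectiveSubspaceTowerFourSubLiouvilleStubFixedFormsRoth
import Summits.ABC.ABC.Theorems.TowerFourSubLiouville.Negative.UniformSavingCeiling

/-!
# `TowerFourSubLiouville` (stmt-ABC-1649): the per-form stratum is sharp at Roth's `2`, and the height
coupling is the whole content of the uniform core

Negative-side calibration (standing disprover, cycle 5, refuter-cdisprove-stmt-ABC-1649-g5-0) of the two
hypotheses of line `fourth-radical-binomial-thue` that had not been tested:

* **`η < 2` in the landed `stub_fixedFormsRoth` is load-bearing and sharp** (`fixedForms_false_above_two`,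
  `not_fixedFormsRoth_without_lt_two`).  For every `η > 2` and every box `H ≥ 8` there is NO threshold `Z₀`
  beyond which all admissible quadruples of the box have `Z^η < |wZ⁴ − vY⁴|`: Dirichlet's approximation
  theorem (Mathlib's `Real.exists_rat_abs_sub_le_and_den_le`) applied to `ξ = 2^{1/4}` gives reduced `Y/Z`
  with `|2Z⁴ − Y⁴| ≤ 43 Z²`, and the two forms `(v,w) = (1,2)` (when `Y` is odd) and `(v,w) = (8,1)` at
  `(Y/2, Z)` (when `Y` is even, so `Z` is odd) absorb the parity so that the registered coprimality
  `gcd(vY, wZ) = 1` always holds; the denominators are forced to infinity by the Liouville inequality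
  `|2^{1/4} − Y/Z| ≥ 1/(43 Z⁴)` (no appeal to irrationality as such: `Y⁴ ≠ 2Z⁴` is a `2`-adic parity).
  So on the fixed-form stratum the dial is EXACTLY `2` (every `η < 2` true by Roth, p85914; every `η > 2`
  false, here; `η = 2` itself is the open bounded-partial-quotient question for `⁴√2` and is not claimed),
  while the uniform dial is `≤ 3/2` (`Negative.UniformSavingCeiling`, p106450): uniformity costs `≥ 1/2`.
* **The height coupling `max v w ≤ Z^η` is the entire content of the uniform statement**
  (`ubq_false_without_height`): with it dropped, `(v,w,Y,Z) = (Z⁴ + 1, 1, 1, Z)` has value exactly `1`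
  (Bezout), so no `η ≥ 0` survives — "uniform in all forms" is false for the trivial reason, and every
  gain must be paid for in the admissible height of the form.

Everything is unconditional and sorry-free; imports: the landed stub file (Mathlib, `stub_fixedFormsRoth`) and
`Negative.UniformSavingCeiling` (`coprime_of_int_combination`).
-/

-- `Summit.ABC.ABC` is the mandated summit-side namespace (CONVENTIONS §2); the duplicate is deliberate.
set_option linter.dupNamespace false

namespace Summit.ABC.ABC.Theorems.TowerFourSubLiouville.Negative

/-! ## Arithmetic of `ξ = 2^{1/4}` -/

/-- `Y⁴ ≠ 2·Z⁴` for naturals with `Z > 0` (the `2`-adic valuation of the left side is `≡ 0`, of the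
right side `≡ 1 (mod 4)`). -/
theorem pow_four_ne_two_mul_pow_four (Y Z : ℕ) (hZ : 0 < Z) : Y ^ 4 ≠ 2 * Z ^ 4 := by
  intro h
  rcases Nat.eq_zero_or_pos Y with hY | hY
  · subst hY; simp at h; omega
  · have h1 := congrArg (fun n => n.factorization 2) h
    rw [Nat.factorization_pow, Nat.factorization_mul (by norm_num) (pow_ne_zero 4 hZ.ne'),
      Nat.factorization_pow] at h1
    simp only [Finsupp.smul_apply, smul_eq_mul, Finsupp.coe_add, Pi.add_apply] at h1
    rw [Nat.Prime.factorization_self Nat.prime_two] at h1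
    omega

/-- A positive real fourth root of `2` exceeds `1`. -/
theorem one_lt_of_pow_four_eq_two {xi : ℝ} (hxi0 : 0 < xi) (hxi : xi ^ 4 = 2) : 1 < xi := by
  by_contra h
  have h1 : xi ≤ 1 := not_lt.mp h
  have : xi ^ 4 ≤ 1 ^ 4 := pow_le_pow_left₀ hxi0.le h1 4
  rw [hxi] at this
  norm_num at this

/-- A positive real fourth root of `2` is below `6/5`. -/
theorem lt_of_pow_four_eq_two {xi : ℝ} (hxi : xi ^ 4 = 2) : xi < 6 / 5 := by
  by_contra h
  have h1 : 6 / 5 ≤ xi := not_lt.mp h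
  have : ((6 : ℝ) / 5) ^ 4 ≤ xi ^ 4 := pow_le_pow_left₀ (by norm_num) h1 4
  rw [hxi] at this
  norm_num at this

/-- The mean-value factor: for `ξ > 0` with `ξ⁴ = 2` and `0 ≤ r ≤ ξ + 1`, `|ξ⁴ − r⁴| ≤ 43 · |ξ − r|`. -/
theorem abs_pow_four_sub_le {xi : ℝ} (hxi0 : 0 < xi) (hxi : xi ^ 4 = 2) {r : ℝ} (hr0 : 0 ≤ r)
    (hr : r ≤ xi + 1) : |xi ^ 4 - r ^ 4| ≤ 43 * |xi - r| := by
  have hfac : xi ^ 4 - r ^ 4 = (xi - r) * (xi ^ 3 + xi ^ 2 * r + xi * r ^ 2 + r ^ 3) := by ring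
  rw [hfac, abs_mul, mul_comm]
  apply mul_le_mul_of_nonneg_right _ (abs_nonneg _)
  have hx := lt_of_pow_four_eq_two hxi
  have hx0 := hxi0
  have hr' : r ≤ 11 / 5 := by linarith
  rw [abs_of_nonneg (by positivity)]
  nlinarith [mul_nonneg hx0.le hr0, mul_nonneg (mul_nonneg hx0.le hx0.le) hr0,
    mul_nonneg hx0.le (mul_nonneg hr0 hr0), pow_le_pow_left₀ hr0 hr' 2, pow_le_pow_left₀ hr0 hr' 3,
    pow_le_pow_left₀ hx0.le hx.le 2, pow_le_pow_left₀ hx0.le hx.le 3,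
    mul_le_mul (pow_le_pow_left₀ hx0.le hx.le 2) hr' hr0 (by positivity),
    mul_le_mul hx.le (pow_le_pow_left₀ hr0 hr' 2) (by positivity) (by positivity)]

/-- **Dirichlet + Liouville for `⁴√2`.** For every bound `B` there are coprime naturals `Y, Z` with
`B < Z`, `0 < Y` and `|2Z⁴ − Y⁴| ≤ 43 Z²` (and `2Z⁴ ≠ Y⁴`). -/
theorem exists_good_approx {xi : ℝ} (hxi0 : 0 < xi) (hxi : xi ^ 4 = 2) (B : ℕ) :
    ∃ Y Z : ℕ, B < Z ∧ 0 < Y ∧ Nat.Coprime Y Z ∧ |(2 * (Z : ℝ) ^ 4 - (Y : ℝ) ^ 4)| ≤ 43 * (Z : ℝ) ^ 2 := by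
  -- Dirichlet with parameter n = 43 (B+1)^3
  set n : ℕ := 43 * (B + 1) ^ 3 with hn
  have hnpos : 0 < n := by positivity
  obtain ⟨q, hq, hqn⟩ := Real.exists_rat_abs_sub_le_and_den_le xi hnpos
  have hden0 : 0 < q.den := q.den_pos
  have hdenR : (0 : ℝ) < q.den := by exact_mod_cast hden0
  have hn1R : (1 : ℝ) ≤ (n : ℝ) + 1 := by
    have : (0 : ℝ) ≤ n := by positivity
    linarith
  -- |ξ - q| ≤ 1
  have hq1 : |xi - q| ≤ 1 := by
    refine le_trans hq ?_
    rw [div_le_one (by positivity)]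
    have : (1 : ℝ) ≤ q.den := by exact_mod_cast hden0
    nlinarith
  -- q > 0, so q.num > 0
  have hqpos : (0 : ℝ) < (q : ℝ) := by
    have := one_lt_of_pow_four_eq_two hxi0 hxi
    have h := abs_le.mp hq1
    linarith
  have hnum_pos : 0 < q.num := by
    have : (0 : ℚ) < q := by exact_mod_cast hqpos
    exact Rat.num_pos.mpr this
  -- Y := q.num.natAbs, Z := q.den
  set Y : ℕ := q.num.natAbs with hY
  set Z : ℕ := q.den with hZ
  have hYnum : (q.num : ℤ) = (Y : ℤ) := by
    rw [hY, Int.natAbs_of_nonneg hnum_pos.le]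
  have hY0 : 0 < Y := by
    rw [hY]; exact Int.natAbs_pos.mpr hnum_pos.ne'
  have hqYZ : (q : ℝ) = (Y : ℝ) / (Z : ℝ) := by
    rw [Rat.cast_def, hZ]
    congr 1
    have : ((q.num : ℤ) : ℝ) = ((Y : ℤ) : ℝ) := by rw [hYnum]
    simpa using this
  have hcop : Nat.Coprime Y Z := by rw [hY, hZ]; exact q.reduced
  have hZR : (0 : ℝ) < (Z : ℝ) := by rw [hZ]; exact hdenR
  -- r := Y / Z satisfies 0 ≤ r ≤ ξ + 1
  have hr0 : (0 : ℝ) ≤ (Y : ℝ) / Z := by positivity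
  have hr1 : (Y : ℝ) / Z ≤ xi + 1 := by
    have h := abs_le.mp hq1
    rw [hqYZ] at h
    linarith
  have hmv := abs_pow_four_sub_le hxi0 hxi hr0 hr1
  -- the integer 2Z⁴ - Y⁴ is nonzero, so |ξ⁴ - r⁴| ≥ 1/Z⁴
  have hne : (2 * (Z : ℝ) ^ 4 - (Y : ℝ) ^ 4) ≠ 0 := by
    have h := pow_four_ne_two_mul_pow_four Y Z (by rw [hZ]; exact hden0)
    intro h0
    apply h
    have : ((Y ^ 4 : ℕ) : ℝ) = ((2 * Z ^ 4 : ℕ) : ℝ) := by push_cast; linarith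
    exact_mod_cast this
  have hint : (1 : ℝ) ≤ |2 * (Z : ℝ) ^ 4 - (Y : ℝ) ^ 4| := by
    -- it is the absolute value of a nonzero integer
    have : ∃ m : ℤ, (2 * (Z : ℝ) ^ 4 - (Y : ℝ) ^ 4) = (m : ℝ) := ⟨2 * (Z : ℤ) ^ 4 - (Y : ℤ) ^ 4, by push_cast; ring⟩
    obtain ⟨m, hm⟩ := this
    rw [hm] at hne ⊢
    have hm0 : m ≠ 0 := by exact_mod_cast hne
    have : (1 : ℤ) ≤ |m| := Int.one_le_abs hm0
    exact_mod_cast this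
  -- |ξ⁴ - r⁴| = |2Z⁴ - Y⁴| / Z⁴
  have hZ4 : (0 : ℝ) < (Z : ℝ) ^ 4 := by positivity
  have hscale : xi ^ 4 - ((Y : ℝ) / Z) ^ 4 = (2 * (Z : ℝ) ^ 4 - (Y : ℝ) ^ 4) / (Z : ℝ) ^ 4 := by
    rw [hxi]; field_simp
  have habs : |xi ^ 4 - ((Y : ℝ) / Z) ^ 4| = |2 * (Z : ℝ) ^ 4 - (Y : ℝ) ^ 4| / (Z : ℝ) ^ 4 := by
    rw [hscale, abs_div, abs_of_pos hZ4]
  -- (1) Liouville: Z is large.  1/Z⁴ ≤ |ξ⁴-r⁴| ≤ 43 |ξ - r| ≤ 43/((n+1) Z)  ⟹  (n+1) ≤ 43 Z³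
  have hqr : |xi - (Y : ℝ) / Z| ≤ 1 / (((n : ℝ) + 1) * Z) := by rw [← hqYZ]; exact hq
  have hlow : 1 / (Z : ℝ) ^ 4 ≤ 43 * (1 / (((n : ℝ) + 1) * Z)) := by
    calc 1 / (Z : ℝ) ^ 4 ≤ |2 * (Z : ℝ) ^ 4 - (Y : ℝ) ^ 4| / (Z : ℝ) ^ 4 :=
          div_le_div_of_nonneg_right hint hZ4.le
      _ = |xi ^ 4 - ((Y : ℝ) / Z) ^ 4| := habs.symm
      _ ≤ 43 * |xi - (Y : ℝ) / Z| := hmv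
      _ ≤ 43 * (1 / (((n : ℝ) + 1) * Z)) := mul_le_mul_of_nonneg_left hqr (by norm_num)
  have hBZ : B < Z := by
    by_contra hle
    have hZB : Z ≤ B := not_lt.mp hle
    have hZBR : (Z : ℝ) ≤ B := by exact_mod_cast hZB
    have hZ1 : (1 : ℝ) ≤ Z := by exact_mod_cast (show 1 ≤ Z from hden0)
    -- from hlow: (n+1) Z ≤ 43 Z⁴, i.e. n + 1 ≤ 43 Z³ ≤ 43 B³ < n + 1
    have h1 : ((n : ℝ) + 1) * Z ≤ 43 * (Z : ℝ) ^ 4 := by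
      have hpos : (0 : ℝ) < ((n : ℝ) + 1) * Z := by positivity
      rw [div_le_iff₀ hZ4] at hlow
      rw [show 43 * (1 / (((n : ℝ) + 1) * Z)) * (Z : ℝ) ^ 4 = 43 * (Z : ℝ) ^ 4 / (((n : ℝ) + 1) * Z) by
        ring] at hlow
      rwa [le_div_iff₀ hpos, one_mul] at hlow
    have h2 : (n : ℝ) + 1 ≤ 43 * (Z : ℝ) ^ 3 := by
      have : ((n : ℝ) + 1) * Z ≤ (43 * (Z : ℝ) ^ 3) * Z := by nlinarith
      exact le_of_mul_le_mul_right this hZR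
    have h3 : (43 : ℝ) * (Z : ℝ) ^ 3 ≤ 43 * (B : ℝ) ^ 3 := by gcongr
    have h4 : (n : ℝ) = 43 * ((B : ℝ) + 1) ^ 3 := by rw [hn]; push_cast; ring
    have hB0 : (0 : ℝ) ≤ B := by positivity
    nlinarith
  -- (2) the value bound: |2Z⁴ - Y⁴| = Z⁴ |ξ⁴ - r⁴| ≤ Z⁴ · 43 /((n+1) Z) ≤ 43 Z² (using Z ≤ n)
  refine ⟨Y, Z, hBZ, hY0, hcop, ?_⟩
  have hZn : (Z : ℝ) ≤ (n : ℝ) + 1 := by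
    have : (Z : ℝ) ≤ n := by exact_mod_cast hqn
    linarith
  have hkey : |2 * (Z : ℝ) ^ 4 - (Y : ℝ) ^ 4| ≤ (Z : ℝ) ^ 4 * (43 * (1 / (((n : ℝ) + 1) * Z))) := by
    have : |2 * (Z : ℝ) ^ 4 - (Y : ℝ) ^ 4| = (Z : ℝ) ^ 4 * |xi ^ 4 - ((Y : ℝ) / Z) ^ 4| := by
      rw [habs]; field_simp
    rw [this]
    exact mul_le_mul_of_nonneg_left (le_trans hmv (mul_le_mul_of_nonneg_left hqr (by norm_num))) hZ4.le
  calc |2 * (Z : ℝ) ^ 4 - (Y : ℝ) ^ 4| ≤ (Z : ℝ) ^ 4 * (43 * (1 / (((n : ℝ) + 1) * Z))) := hkey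
    _ = 43 * (Z : ℝ) ^ 2 * ((Z : ℝ) / ((n : ℝ) + 1)) := by field_simp
    _ ≤ 43 * (Z : ℝ) ^ 2 * 1 := by
        apply mul_le_mul_of_nonneg_left _ (by positivity)
        rw [div_le_one (by positivity)]
        exact hZn
    _ = 43 * (Z : ℝ) ^ 2 := by ring

/-! ## The per-form stratum fails for every `η > 2` -/

/-- **Roth's exponent is sharp on the fixed-form stratum.**  For every real `η > 2` and every box
`H ≥ 8` the matrix of `stub_fixedFormsRoth` (unfolded verbatim) has NO threshold `Z₀`: the forms
`2Z⁴ − Y⁴` (`Y` odd) and `Z⁴ − 8Y₁⁴` (`Y = 2Y₁`, `Z` odd) take values `≤ 43 Z²` at the Dirichlet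
approximants of `⁴√2`, with the registered coprimality `gcd(vY, wZ) = 1` in both cases. -/
theorem fixedForms_false_above_two (η : ℝ) (hη : 2 < η) (H : ℕ) (hH : 8 ≤ H) :
    ¬ ∃ Z₀ : ℕ, ∀ v w Y Z : ℕ, Z₀ ≤ Z → max v w ≤ H → 0 < v → 0 < w → 0 < Y →
      Nat.Coprime (v * Y) (w * Z) → ((max v w : ℕ) : ℝ) ≤ (Z : ℝ) ^ η → w * Z ^ 4 ≠ v * Y ^ 4 →
      (Z : ℝ) ^ η < |((w * Z ^ 4 : ℕ) : ℝ) - ((v * Y ^ 4 : ℕ) : ℝ)| := by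
  rintro ⟨Z₀, h⟩
  -- a bound B with B ≥ Z₀, B ≥ 3 and B^(η-2) ≥ 43
  have hη2 : 0 < η - 2 := by linarith
  obtain ⟨B₁, hB₁⟩ := exists_nat_ge ((43 : ℝ) ^ (1 / (η - 2)))
  set B : ℕ := max (max Z₀ 3) B₁ with hBdef
  obtain ⟨xi, hxi0, hxi⟩ : ∃ xi : ℝ, 0 < xi ∧ xi ^ 4 = 2 := by
    obtain ⟨θ, hθ, hθ4⟩ := fixedFormsRoth_exists_fourth_root (v := 1) (w := 2) one_pos two_pos
    exact ⟨θ, hθ, by rw [hθ4]; norm_num⟩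
  obtain ⟨Y, Z, hBZ, hY0, hcop, hval⟩ := exists_good_approx hxi0 hxi B
  have hZ₀ : Z₀ ≤ Z := le_of_lt (lt_of_le_of_lt (le_trans (le_max_left _ _) (le_max_left _ _)) hBZ)
  have hZ3 : 3 ≤ Z := le_of_lt (lt_of_le_of_lt (le_trans (le_max_right _ _) (le_max_left _ _)) hBZ)
  have hZB₁ : B₁ ≤ Z := le_of_lt (lt_of_le_of_lt (le_max_right _ _) hBZ)
  have hZpos : 0 < Z := by omega
  have hZR1 : (1 : ℝ) ≤ Z := by exact_mod_cast hZpos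
  have hZR : (0 : ℝ) < Z := by positivity
  -- Z^η ≥ 43 Z² and Z^η ≥ 9
  have hpow : 43 * (Z : ℝ) ^ 2 ≤ (Z : ℝ) ^ η := by
    have h43 : (43 : ℝ) ≤ (Z : ℝ) ^ (η - 2) := by
      have hB₁R : (43 : ℝ) ^ (1 / (η - 2)) ≤ Z := le_trans hB₁ (by exact_mod_cast hZB₁)
      calc (43 : ℝ) = ((43 : ℝ) ^ (1 / (η - 2))) ^ (η - 2) := by
            rw [← Real.rpow_mul (by norm_num), one_div_mul_cancel hη2.ne', Real.rpow_one]
        _ ≤ (Z : ℝ) ^ (η - 2) := Real.rpow_le_rpow (by positivity) hB₁R hη2.le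
    have hsplit : (Z : ℝ) ^ η = (Z : ℝ) ^ (η - 2) * (Z : ℝ) ^ 2 := by
      rw [show (Z : ℝ) ^ 2 = (Z : ℝ) ^ ((2 : ℕ) : ℝ) from (Real.rpow_natCast _ 2).symm,
        ← Real.rpow_add hZR]
      norm_num
    rw [hsplit]
    have : (0 : ℝ) ≤ (Z : ℝ) ^ 2 := by positivity
    nlinarith
  have hnine : (8 : ℝ) ≤ (Z : ℝ) ^ η := by
    have h9 : (9 : ℝ) ≤ (Z : ℝ) ^ 2 := by
      have : (3 : ℝ) ≤ Z := by exact_mod_cast hZ3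
      nlinarith
    nlinarith [hpow]
  have hne := pow_four_ne_two_mul_pow_four Y Z hZpos
  rcases Nat.even_or_odd Y with ⟨Y₁, hY₁⟩ | hodd
  · -- Y even, Y = Y₁ + Y₁: Z odd, form (v,w) = (8,1) at (Y₁, Z)
    have hY2 : Y = 2 * Y₁ := by omega
    have hY₁0 : 0 < Y₁ := by omega
    have h2Z : Nat.Coprime 2 Z := Nat.Coprime.coprime_dvd_left ⟨Y₁, hY2⟩ hcop
    have h8Z : Nat.Coprime 8 Z := by
      have h := Nat.Coprime.pow_left 3 h2Z
      rwa [show (2 : ℕ) ^ 3 = 8 from rfl] at h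
    have hY₁Z : Nat.Coprime Y₁ Z := Nat.Coprime.coprime_dvd_left ⟨2, by omega⟩ hcop
    have hcop' : Nat.Coprime (8 * Y₁) (1 * Z) := by
      rw [one_mul]; exact Nat.Coprime.mul_left h8Z hY₁Z
    have hne' : 1 * Z ^ 4 ≠ 8 * Y₁ ^ 4 := by
      intro h0
      apply hne
      rw [hY2]
      calc (2 * Y₁) ^ 4 = 2 * (8 * Y₁ ^ 4) := by ring
        _ = 2 * (1 * Z ^ 4) := by rw [h0]
        _ = 2 * Z ^ 4 := by ring
    have hmax : max 8 1 ≤ H := by rw [show max 8 1 = 8 by norm_num]; exact hH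
    have hle : ((max 8 1 : ℕ) : ℝ) ≤ (Z : ℝ) ^ η := by
      rw [show (max 8 1 : ℕ) = 8 by norm_num]; push_cast; exact hnine
    have key := h 8 1 Y₁ Z hZ₀ hmax (by norm_num) (by norm_num) hY₁0 hcop' hle hne'
    have hcast : |((1 * Z ^ 4 : ℕ) : ℝ) - ((8 * Y₁ ^ 4 : ℕ) : ℝ)| = |(Z : ℝ) ^ 4 - 8 * (Y₁ : ℝ) ^ 4| := by
      push_cast; ring_nf
    rw [hcast] at key
    have hYR : (Y : ℝ) = 2 * (Y₁ : ℝ) := by exact_mod_cast hY2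
    have hval' : 2 * |(Z : ℝ) ^ 4 - 8 * (Y₁ : ℝ) ^ 4| ≤ 43 * (Z : ℝ) ^ 2 := by
      have e : 2 * (Z : ℝ) ^ 4 - (Y : ℝ) ^ 4 = 2 * ((Z : ℝ) ^ 4 - 8 * (Y₁ : ℝ) ^ 4) := by
        rw [hYR]; ring
      rw [e, abs_mul, abs_of_pos (by norm_num : (0 : ℝ) < 2)] at hval
      exact hval
    have habs0 : (0 : ℝ) ≤ |(Z : ℝ) ^ 4 - 8 * (Y₁ : ℝ) ^ 4| := abs_nonneg _
    linarith
  · -- Y odd: form (v,w) = (1,2) at (Y, Z)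
    obtain ⟨k, hk⟩ := hodd
    have hY2 : Nat.Coprime Y 2 := by
      rw [Nat.coprime_comm, Nat.Prime.coprime_iff_not_dvd Nat.prime_two]
      omega
    have hcop' : Nat.Coprime (1 * Y) (2 * Z) := by
      rw [one_mul]; exact Nat.Coprime.mul_right hY2 hcop
    have hne' : 2 * Z ^ 4 ≠ 1 * Y ^ 4 := fun h0 => hne (by rw [one_mul] at h0; exact h0.symm)
    have hmax : max 1 2 ≤ H := by rw [show max 1 2 = 2 by norm_num]; omega
    have hle : ((max 1 2 : ℕ) : ℝ) ≤ (Z : ℝ) ^ η := by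
      rw [show (max 1 2 : ℕ) = 2 by norm_num]; push_cast; linarith
    have key := h 1 2 Y Z hZ₀ hmax (by norm_num) (by norm_num) hY0 hcop' hle hne'
    have hcast : |((2 * Z ^ 4 : ℕ) : ℝ) - ((1 * Y ^ 4 : ℕ) : ℝ)| = |2 * (Z : ℝ) ^ 4 - (Y : ℝ) ^ 4| := by
      push_cast; ring_nf
    rw [hcast] at key
    linarith

/-- Hence the landed `stub_fixedFormsRoth` with its hypothesis `η < 2` DROPPED is false: on the per-form
stratum the saving dial is exactly Roth's `2` (tested at `H = 8`, `η = 3`). -/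
theorem not_fixedFormsRoth_without_lt_two :
    ¬ ∀ H : ℕ, ∀ η : ℝ, 0 < η → ∃ Z₀ : ℕ, ∀ v w Y Z : ℕ, Z₀ ≤ Z → max v w ≤ H → 0 < v → 0 < w →
      0 < Y → Nat.Coprime (v * Y) (w * Z) → ((max v w : ℕ) : ℝ) ≤ (Z : ℝ) ^ η →
      w * Z ^ 4 ≠ v * Y ^ 4 → (Z : ℝ) ^ η < |((w * Z ^ 4 : ℕ) : ℝ) - ((v * Y ^ 4 : ℕ) : ℝ)| :=
  fun h => fixedForms_false_above_two 3 (by norm_num) 8 le_rfl (h 8 3 (by norm_num))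

/-- For contrast, the landed positive stratum: every `η < 2` IS a saving on every box (Roth, p85914). -/
example : ∀ H : ℕ, ∀ η : ℝ, 0 < η → η < 2 → ∃ Z₀ : ℕ, ∀ v w Y Z : ℕ, Z₀ ≤ Z → max v w ≤ H → 0 < v →
    0 < w → 0 < Y → Nat.Coprime (v * Y) (w * Z) → ((max v w : ℕ) : ℝ) ≤ (Z : ℝ) ^ η →
    w * Z ^ 4 ≠ v * Y ^ 4 → (Z : ℝ) ^ η < |((w * Z ^ 4 : ℕ) : ℝ) - ((v * Y ^ 4 : ℕ) : ℝ)| :=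
  stub_fixedFormsRoth

/-! ## The height coupling is the whole content of the uniform statement -/

/-- **Without `max v w ≤ Z^η` no `η ≥ 0` survives**: the hypothesis `UBQ η` of the landed `stub_transfer`
with the height coupling dropped is false for every `η ≥ 0`, by the Bezout witness
`(v, w, Y, Z) = (Z⁴ + 1, 1, 1, Z)` of value exactly `1` (`gcd((Z⁴+1)·1, 1·Z) = 1`). -/
theorem ubq_false_without_height (η : ℝ) (hη : 0 ≤ η) :
    ¬ ∃ Z₀ : ℕ, ∀ v w Y Z : ℕ, Z₀ ≤ Z → 0 < v → 0 < w → 0 < Y → Nat.Coprime (v * Y) (w * Z) →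
      w * Z ^ 4 ≠ v * Y ^ 4 → (Z : ℝ) ^ η < |((w * Z ^ 4 : ℕ) : ℝ) - ((v * Y ^ 4 : ℕ) : ℝ)| := by
  rintro ⟨Z₀, h⟩
  set Z : ℕ := max Z₀ 1 with hZ
  have hZ1 : 1 ≤ Z := le_max_right _ _
  -- witness (v, w, Y, Z) = (Z⁴ + 1, 1, 1, Z): value wZ⁴ - vY⁴ = -1
  have hcop : Nat.Coprime ((Z ^ 4 + 1) * 1) (1 * Z) := by
    rw [mul_one, one_mul]
    exact coprime_of_int_combination (a := 1) (b := -((Z : ℤ) ^ 3)) (r := 1)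
      (by push_cast; ring) (Nat.coprime_one_left _)
  have hne : 1 * Z ^ 4 ≠ (Z ^ 4 + 1) * 1 ^ 4 := by
    rw [one_pow, mul_one, one_mul]; exact (Nat.lt_succ_self _).ne
  have key := h (Z ^ 4 + 1) 1 1 Z (le_max_left _ _) (Nat.succ_pos _) one_pos one_pos hcop hne
  have hcast : |((1 * Z ^ 4 : ℕ) : ℝ) - (((Z ^ 4 + 1) * 1 ^ 4 : ℕ) : ℝ)| = 1 := by
    push_cast
    rw [show (1 : ℝ) * (Z : ℝ) ^ 4 - ((Z : ℝ) ^ 4 + 1) * 1 = -1 by ring]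
    norm_num
  rw [hcast] at key
  have hZR : (1 : ℝ) ≤ Z := by exact_mod_cast hZ1
  have : (1 : ℝ) ≤ (Z : ℝ) ^ η := Real.one_le_rpow hZR hη
  linarith

end Summit.ABC.ABC.Theorems.TowerFourSubLiouville.Negative
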